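import Mathlib
import HarnessLib
import Summits.ABC.ABC.Statement
import Summits.ABC.ABC.Theorems.SoloBlindOmega3Leaves

/-!
# `ω(abc) = 3`: the KNOWN side in one statement — `log c ≤ 10¹³ · log p · log q · (1 + log log max(p, q)) + log 2`

`Summits/ABC/ABC/Theorems/SoloBlindOmega3Known.lean`; namespace `Summit.ABC.ABC.Theorems`
(solo seat `solo-ABC-blind`, wall coordinate C1⁗(1); the capstone of `SoloBlindShapeBKnown`,
`SoloBlindTwoadicCore`, `SoloBlindOmega3Prelude`, `SoloBlindPow2EndKnown`, `SoloBlindShapeAKnown`,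
`SoloBlindShapeCDKnown`, `SoloBlindOmega3Leaves`).

* `omega3_log_c_le` : granting `bugeaudLaurent1996_rat` (Bugeaud–Laurent 1996, two `2`-adic logarithms) and
  `matveev2000_linearFormsLog_rat` (Matveev 2000 over `ℚ`), for EVERY abc triple with
  `(abc).primeFactors = {2, p, q}` (`p ≠ q` odd primes):
  `log c ≤ 10¹³ · log p · log q · (1 + log log max(p, q)) + log 2`;
* `omega3_log_c_le_rad` : against the radical `rad(abc) = 2pq`:
  `log c ≤ (10¹³/4) · (log rad)² · (1 + log log rad) + log 2`.

READING (the wall at its first open case, typed on both sides).  `ω(abc) ≤ 2` is Catalan territory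
(`SoloBlindTwoPrimes`); restricting `abc` to `ω ≥ k` is free (`SoloBlindThresholds`), so `ω = 3` is a
consequence of `abc`, not a rung toward it — but it is the first case that is not a theorem, and
`ω(abc) = 3` forces `S = {2, p, q}` (parity).  There:
    known (this file, modulo the two named facts):  `c < 2 · rad^{C · log rad · (1 + log log rad)}`, `C = 10¹³/4`;
    `abc` (`abc_iff_logLinearOmega` at `ω = 3`):     `c < K_ε · rad^{1+ε}`;
    generic (Stewart–Yu 2001):                       `c < exp (C' · rad^{1/3} (log rad)³)`.
At three primes the conjecture is open by a factor `log rad · log log rad` IN THE EXPONENT — the product of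
the two odd heights against their sum — and by nothing else: no `N(𝔭)` enters, because with `2 ∈ S` and
`|S| = 3` every shape is decided by the `2`-adic estimate (price `N(2) = 2`) or by an archimedean one.  At
`|S| = 4` a valuation at an odd prime becomes unavoidable when all terms are comparable, and the price
`min_{p ∈ S odd} p` of the generic bounds returns.

Trust base: the two named facts, as hypotheses; everything else is proved.  Constants crude by choice.
-/

noncomputable section

namespace Summit.ABC.ABC.Theorems

open Real Literature.NumberTheory.Transcendental Literature.NumberTheory.DiophantineGeometry
  Literature.NumberTheory.DiophantineGeometry.Dioph

/-- **The known side at `ω = 3`, all six shapes in one statement.**  Granting the two named facts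
(Bugeaud–Laurent 1996 over `ℚ`, Matveev 2000 over `ℚ`): for every coprime `a + b = c` whose prime support
is exactly `{2, p, q}` (`p ≠ q` odd primes),
`log c ≤ 10¹³ · log p · log q · (1 + log log max(p, q)) + log 2`
— the PRODUCT of the two odd heights, uniformly in all exponents, with no `N(𝔭)`.  (`abc` on these triples
reads `log c ≤ (1 + ε)(log 2 + log p + log q) + O_ε(1)`: their SUM.) [folklore] -/
theorem omega3_log_c_le (hBL : bugeaudLaurent1996_rat) (hM : matveev2000_linearFormsLog_rat)
    {p q a b c : ℕ} (hp : p.Prime) (hq : q.Prime) (hp2 : p ≠ 2) (hq2 : q ≠ 2) (hpq : p ≠ q)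
    (habc : IsABCTriple a b c) (hS : (a * b * c).primeFactors = {2, p, q}) :
    Real.log c ≤
      10 ^ 13 * Real.log p * Real.log q * (1 + Real.log (Real.log (max (p : ℝ) q))) + Real.log 2 := by
  obtain ⟨ha, hb, heq, hcop⟩ := id habc
  have hc : 0 < c := by omega
  have hac : Nat.Coprime a c := by rw [← heq]; exact Nat.coprime_self_add_right.mpr hcop
  have hbc : Nat.Coprime b c := by rw [← heq]; exact Nat.coprime_add_self_right.mpr hcop.symm
  have hmem : ∀ d, d.Prime → d ∣ a * b * c → d = 2 ∨ d = p ∨ d = q := by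
    intro d hd hdd
    have : d ∈ (a * b * c).primeFactors := Nat.mem_primeFactors.mpr ⟨hd, hdd, by positivity⟩
    rw [hS] at this
    simpa using this
  have excl : ∀ {m n r : ℕ}, Nat.Coprime m n → r.Prime → r ∣ m → ¬ r ∣ n := by
    intro m n r hmn hr hrm hrn
    have := Nat.dvd_gcd hrm hrn
    rw [hmn.gcd_eq_one] at this
    exact hr.one_lt.ne' (Nat.dvd_one.mp this)
  have hdvd : ∀ {r : ℕ}, r ∈ ({2, p, q} : Finset ℕ) → r ∣ a * b * c := by
    intro r hr
    rw [← hS] at hr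
    exact (Nat.mem_primeFactors.mp hr).2.1
  have h2 : 2 ∣ a * b * c := hdvd (by simp)
  have hp' : p ∣ a * b * c := hdvd (by simp)
  have hq' : q ∣ a * b * c := hdvd (by simp)
  have habc' : IsABCTriple b a c := ⟨hb, ha, by omega, hcop.symm⟩
  have hS' : (b * a * c).primeFactors = {2, p, q} := by rw [mul_comm b a]; exact hS
  have hSqp : (a * b * c).primeFactors = {2, q, p} := by rw [hS, Finset.pair_comm]
  have hSqp' : (b * a * c).primeFactors = {2, q, p} := by rw [mul_comm b a]; exact hSqp
  have symmU : ∀ {x : ℝ},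
      x ≤ 10 ^ 13 * Real.log q * Real.log p * (1 + Real.log (Real.log (max (q : ℝ) p))) + Real.log 2 →
      x ≤ 10 ^ 13 * Real.log p * Real.log q * (1 + Real.log (Real.log (max (p : ℝ) q))) + Real.log 2 := by
    intro x hx
    rw [max_comm] at hx
    linarith
  rcases Nat.prime_two.dvd_mul.mp h2 with h2ab | h2c
  · -- 2 ∣ a or 2 ∣ b; the prime of c is q or p
    have case_a : ∀ {a b : ℕ}, IsABCTriple a b c → (a * b * c).primeFactors = {2, p, q} →
        (a * b * c).primeFactors = {2, q, p} → 2 ∣ a →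
        Real.log c ≤ 10 ^ 13 * Real.log p * Real.log q *
          (1 + Real.log (Real.log (max (p : ℝ) q))) + Real.log 2 := by
      intro a b habc hS hSqp h2a
      by_cases hqc : q ∣ c
      · exact omega3_leaf_two_dvd_a hBL hM hp hq hp2 hq2 hpq habc hS h2a hqc
      by_cases hpc : p ∣ c
      · exact symmU (omega3_leaf_two_dvd_a hBL hM hq hp hq2 hp2 (Ne.symm hpq) habc hSqp h2a hpc)
      · exfalso
        obtain ⟨ha, hb, heq, hcop⟩ := habc
        have hac : Nat.Coprime a c := by rw [← heq]; exact Nat.coprime_self_add_right.mpr hcop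
        have hc1 : c = 1 := Nat.eq_one_iff_not_exists_prime_dvd.mpr fun d hd hdc => by
          have hmem' : d ∈ (a * b * c).primeFactors :=
            Nat.mem_primeFactors.mpr ⟨hd, hdc.mul_left _, by positivity⟩
          rw [hS] at hmem'
          simp only [Finset.mem_insert, Finset.mem_singleton] at hmem'
          rcases hmem' with rfl | rfl | rfl
          · exact excl hac Nat.prime_two h2a hdc
          · exact hpc hdc
          · exact hqc hdc
        omega
    rcases Nat.prime_two.dvd_mul.mp h2ab with h2a | h2b
    · exact case_a habc hS hSqp h2a
    · exact case_a habc' hS' hSqp' h2b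
  · -- 2 ∣ c; the odd prime of a (or b) is p or q
    rcases hp.dvd_mul.mp hp' with hpab | hpc
    · rcases hp.dvd_mul.mp hpab with hpa | hpb
      · exact omega3_leaf_two_dvd_c hBL hM hp hq hp2 hq2 hpq habc hS h2c hpa
      · exact omega3_leaf_two_dvd_c hBL hM hp hq hp2 hq2 hpq habc' hS' h2c hpb
    · rcases hq.dvd_mul.mp hq' with hqab | hqc
      · rcases hq.dvd_mul.mp hqab with hqa | hqb
        · exact symmU (omega3_leaf_two_dvd_c hBL hM hq hp hq2 hp2 (Ne.symm hpq) habc hSqp h2c hqa)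
        · exact symmU (omega3_leaf_two_dvd_c hBL hM hq hp hq2 hp2 (Ne.symm hpq) habc' hSqp' h2c hqb)
      · exfalso
        -- 2, p, q all divide c: a = b = 1, c = 2, p ∣ 2
        have ha1 : a = 1 := Nat.eq_one_iff_not_exists_prime_dvd.mpr fun d hd hda => by
          rcases hmem d hd ((hda.mul_right b).mul_right c) with rfl | rfl | rfl
          · exact excl hac Nat.prime_two hda h2c
          · exact excl hac hp hda hpc
          · exact excl hac hq hda hqc
        have hb1 : b = 1 := Nat.eq_one_iff_not_exists_prime_dvd.mpr fun d hd hdb => by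
          rcases hmem d hd ((hdb.mul_left a).mul_right c) with rfl | rfl | rfl
          · exact excl hbc Nat.prime_two hdb h2c
          · exact excl hbc hp hdb hpc
          · exact excl hbc hq hdb hqc
        have hc2 : c = 2 := by omega
        rw [hc2] at hpc
        exact hp2 ((Nat.prime_dvd_prime_iff_eq hp Nat.prime_two).mp hpc)

/-- **The known side at `ω = 3` against the radical.**  With `rad(abc) = 2pq`:
`log c ≤ (10¹³/4) · (log rad)² · (1 + log log rad) + log 2`, i.e. `c < 2 · rad^{(10¹³/4) · log rad · (1 + log log rad)}`
— quasi-polynomial in the radical, where `abc` asks for `rad^{1+ε}` and the generic Stewart–Yu bound is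
`exp (C · rad^{1/3} (log rad)³)`.  Granting the two named facts. [folklore] -/
theorem omega3_log_c_le_rad (hBL : bugeaudLaurent1996_rat) (hM : matveev2000_linearFormsLog_rat)
    {p q a b c : ℕ} (hp : p.Prime) (hq : q.Prime) (hp2 : p ≠ 2) (hq2 : q ≠ 2) (hpq : p ≠ q)
    (habc : IsABCTriple a b c) (hS : (a * b * c).primeFactors = {2, p, q}) :
    Real.log c ≤ 10 ^ 13 / 4 * Real.log ((rad a b c : ℕ) : ℝ) ^ 2 *
      (1 + Real.log (Real.log ((rad a b c : ℕ) : ℝ))) + Real.log 2 := by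
  have key := omega3_log_c_le hBL hM hp hq hp2 hq2 hpq habc hS
  have hp3 : 3 ≤ p := by have := hp.two_le; omega
  have hq3 : 3 ≤ q := by have := hq.two_le; omega
  have hP : 1 < Real.log p := one_lt_log_of_three_le hp3
  have hQ : 1 < Real.log q := one_lt_log_of_three_le hq3
  have hlog2 : 0 < Real.log 2 := Real.log_pos (by norm_num)
  have hpR : (0 : ℝ) < p := by exact_mod_cast hp.pos
  have hqR : (0 : ℝ) < q := by exact_mod_cast hq.pos
  have hrad : rad a b c = 2 * p * q := by
    rw [rad_def, Nat.radical_eq_prod_primeFactors, hS,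
      Finset.prod_insert (by simp only [Finset.mem_insert, Finset.mem_singleton]; omega),
      Finset.prod_insert (by simpa using hpq), Finset.prod_singleton]
    ring
  have hR : ((rad a b c : ℕ) : ℝ) = 2 * p * q := by exact_mod_cast hrad
  have hlogR : Real.log ((rad a b c : ℕ) : ℝ) = Real.log 2 + Real.log p + Real.log q := by
    rw [hR, Real.log_mul (by positivity) hqR.ne', Real.log_mul (by norm_num) hpR.ne']
  have hmax : max (p : ℝ) q ≤ ((rad a b c : ℕ) : ℝ) := by
    rw [hR]
    have hp1 : (1 : ℝ) ≤ p := by exact_mod_cast hp.one_lt.le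
    have hq1 : (1 : ℝ) ≤ q := by exact_mod_cast hq.one_lt.le
    exact max_le (by nlinarith) (by nlinarith)
  have hmax0 : 1 < Real.log (max (p : ℝ) q) :=
    lt_of_lt_of_le hP (Real.log_le_log hpR (le_max_left _ _))
  have hLL : Real.log (Real.log (max (p : ℝ) q)) ≤ Real.log (Real.log ((rad a b c : ℕ) : ℝ)) :=
    Real.log_le_log (by linarith) (Real.log_le_log (lt_of_lt_of_le hpR (le_max_left _ _)) hmax)
  have hLL0 : 0 ≤ Real.log (Real.log (max (p : ℝ) q)) := Real.log_nonneg hmax0.le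
  have hPQ : Real.log p * Real.log q ≤ Real.log ((rad a b c : ℕ) : ℝ) ^ 2 / 4 := by
    rw [hlogR]
    nlinarith [sq_nonneg (Real.log p - Real.log q), hlog2.le, hP.le, hQ.le]
  have h3 : Real.log p * Real.log q * (1 + Real.log (Real.log (max (p : ℝ) q))) ≤
      Real.log ((rad a b c : ℕ) : ℝ) ^ 2 / 4 * (1 + Real.log (Real.log ((rad a b c : ℕ) : ℝ))) :=
    mul_le_mul hPQ (by linarith) (by linarith) (by positivity)
  nlinarith [h3, key]

end Summit.ABC.ABC.Theorems

end
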